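import Literature.Analysis.FluidPDE.HouLiVariablesMemLp
import Literature.Analysis.FluidPDE.AxisymPhiFourEnergy
import Literature.Analysis.FluidPDE.AxisymQuotientBounds
import Literature.Analysis.FluidPDE.TaoClassGlue
import HarnessLib

/-!
# Lei–Zhang 2017, Thm. 1.4: the differential inequality (7-1) + (7-2) at a fixed time,
# in Tao's class (`d/dt (‖V²‖² + ‖Ω‖²) ≤ 0` under `‖Ω‖^{1/2}‖Γ‖₂^{1/2}‖Γ‖_∞^{1/2} ≲ 1`)

Analysis/FluidPDE proof file (theorems only; no definitions, no named facts) on the discharge path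
of the named fact `Literature.Analysis.FluidPDE.LeiZhang2017_smallSwirl_regularity`
(Lei–Zhang 2017, Thm. 1.4, first alternative).

Lei–Zhang (arXiv:1505.02628, §4, p. 10) combine the energy estimate (7-1) of `Ω = ω^θ/r`, the `L⁴`
estimate (7-2) of `V = v^θ/√r`, Lemma 2.1 (`‖vʳ/r‖_∞ ≲ ‖Ω‖^{1/2}‖∂_zΩ‖^{1/2}`) and the interpolation
`‖V‖⁴_{L⁴} ≲ ‖r⁻¹V²‖^{3/2}_{L²} ‖Γ‖_{L⁴}`:

> "`d/dt (‖V²‖² + ‖Ω‖²) + (‖∇V²‖² + ‖∇Ω‖²) ≲ ‖Ω‖^{1/2}‖Γ‖^{1/2}_{L²}‖Γ‖^{1/2}_{L^∞}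
> (‖∂_zΩ‖² + ‖r⁻¹V²‖²)`" … "Hence, by (S7-7), we derive that `d/dt (‖V²‖² + ‖Ω‖²) ≤ 0`."

In the smooth Hou–Li variables `Φ = angVelQuot (u t) = v^θ/r`, `Ω = angVortQuot (u t)`,
`W = radVelQuot (u t) = vʳ/r` (`‖V²‖²_{L²} = ∫ r²Φ⁴`, `‖r⁻¹V²‖²_{L²} = ∫ Φ⁴`) this file proves the
**fixed-time inequality** behind the displayed chain for a Tao-class solution (`ν = 1`) with
axisymmetric slices at a time `τ ∈ [0, T]`:

* `IsTaoSolutionOn.smallSwirl_slice_le` — if `|Γ(τ)| ≤ M`, `Γ(τ) ∈ L²` and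
  `C_A (‖Ω(τ)‖²_{L²} · M² ‖Γ(τ)‖²_{L²})^{1/4} ≤ 1/3` (`C_A` the absolute constant of
  `HouLeiLiSupBound`), then
  `4 ∫ r²Φ³Φ' + 2 ∫ Ω Ω' ≤ −½ ∫ |∇Ω|² − 2 ∫ r²Φ²|∇Φ|²`
  (`Φ' = angVelQuot (∂ₜu τ)`, `Ω' = angVortQuot (∂ₜu τ)`), i.e. the density of
  `d/dt (‖V²‖² + ‖Ω‖²)` is `≤ −½‖∇Ω‖² − ½(‖∇V²‖² + ‖r⁻¹V²‖²)/2 ≤ 0`.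

The inputs, all at the fixed time and all with their `L²` provisos discharged in Tao's class
(`HouLiVariablesMemLp`, `AxisymQuotientRayAverage`): the `Ω`-inequality
`∫ΩΩ' + ∫|∇Ω|² ≤ −2∫ΩΦJ` (`AxisymOmegaEnergy`, sibling seat) with `J = −∂_zΦ`
(`AxisymQuotientBounds`) and `2∫ΩΦ∂_zΦ = −∫∂_zΩ Φ² ≤ ½∫(∂_zΩ)² + ½∫Φ⁴`
(`two_mul_integral_mul_mul_fderiv_le`); the `Φ⁴`-identity
`4∫r²Φ³Φ' = −12∫r²Φ²|∇Φ|² − 6∫r²WΦ⁴` and the Hardy bound `∫Φ⁴ ≤ 4∫r²Φ²|∇ₕΦ|²`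
(`AxisymPhiFourEnergy`); the sup bound `|W| ≤ C_A(∫Ω² ∫(∂_zΩ)²)^{1/4}`
(`IsAxisymmetric.abs_radVelQuot_le_of_sobolev`); the interpolation
`∫r²Φ⁴ = ∫|Φ|³|Γ| ≤ (∫Φ⁴)^{1/2}(∫Φ⁴ · M²∫Γ²)^{1/4}` (Cauchy–Schwarz twice,
`integral_abs_pow_three_mul_abs_le`); and Young's inequality
`a^{1/4}P^{3/4} ≤ a/4 + 3P/4` (`young_quarter_three_quarters`, all fourth roots written `√√`).

## Mathlib / tree search

Tree: `IsClassicalNSSolutionOn.angVortQuot_energy_le` (`AxisymOmegaEnergy`),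
`IsAxisymmetric.radVelQuot_curl_eq_neg_fderiv_angVelQuot` (`AxisymQuotientBounds`),
`IsClassicalNSSolutionOn.integral_horizSq_mul_angVelQuot_cube_eq`, `integral_pow_four_le_four_mul`,
`IsAxisymmetric.horizSq_mul_angVelQuot_sq_le` (`AxisymPhiFourEnergy`),
`IsAxisymmetric.abs_radVelQuot_le_of_sobolev`, `memLp_*_of_sobolev` (`HouLiVariablesMemLp`),
`IsAxisymmetric.lintegral_sq_iteratedFDeriv_*_lt_top`, `…norm_iteratedFDeriv_*_le`,
`HasBoundedSobolevNormsOn.exists_forall_norm_iteratedFDeriv_le` (`AxisymQuotientRayAverage`),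
`IsSmoothSpaceTimeOn.isAxisymmetric_timeDerivWithin` (`AxisymQuotientEquations`),
`integral_mul_le_sqrt_mul_sqrt_of_memLp` (`EnergyToolkit`).  Mathlib:
`integral_mul_fderiv_eq_neg_fderiv_mul_of_integrable`, `Real.sqrt_eq_rpow`, `closure_Ioo`, `interior_Icc`.

## References

* Z. Lei, Q. S. Zhang, Pacific J. Math. 289 (2017) 169–187, arXiv:1505.02628, §4, (7-1)–(7-3)
  (p. 10). [`LeiZhang2017`]
-/

noncomputable section

open MeasureTheory Set Function Filter Topology InnerProductSpace WithLp
open scoped RealInnerProductSpace Laplacian ContDiff ENNReal NNReal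

namespace Literature.Analysis.FluidPDE

/-! ### Real-variable inequalities -/

section RealLemmas

/-- **Young's inequality `a^{1/4} P^{3/4} ≤ a/4 + 3P/4`**, fourth roots written as `√√`:
`√√a · (√P · √√P) ≤ a/4 + 3P/4` (`4αβ³ ≤ α⁴ + 3β⁴`, i.e. `(α−β)²(α²+2αβ+3β²) ≥ 0`). [folklore] -/
theorem young_quarter_three_quarters {a P : ℝ} (ha : 0 ≤ a) (hP : 0 ≤ P) :
    Real.sqrt (Real.sqrt a) * (Real.sqrt P * Real.sqrt (Real.sqrt P)) ≤ a / 4 + 3 * P / 4 := by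
  set α := Real.sqrt (Real.sqrt a) with hα
  set β := Real.sqrt (Real.sqrt P) with hβ
  have hα0 : 0 ≤ α := Real.sqrt_nonneg _
  have hβ0 : 0 ≤ β := Real.sqrt_nonneg _
  have hα2 : α ^ 2 = Real.sqrt a := Real.sq_sqrt (Real.sqrt_nonneg _)
  have hβ2 : β ^ 2 = Real.sqrt P := Real.sq_sqrt (Real.sqrt_nonneg _)
  have hα4 : α ^ 4 = a := by
    rw [show (4 : ℕ) = 2 * 2 from rfl, pow_mul, hα2, Real.sq_sqrt ha]
  have hβ4 : β ^ 4 = P := by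
    rw [show (4 : ℕ) = 2 * 2 from rfl, pow_mul, hβ2, Real.sq_sqrt hP]
  rw [← hβ2]
  have hid : α ^ 4 + 3 * β ^ 4 - 4 * (α * (β ^ 2 * β)) = (α - β) ^ 2 * (α ^ 2 + 2 * α * β + 3 * β ^ 2) := by
    ring
  have hnn : 0 ≤ (α - β) ^ 2 * (α ^ 2 + 2 * α * β + 3 * β ^ 2) := by positivity
  rw [← hα4, ← hβ4]
  linarith

end RealLemmas

/-! ### `2∫ΩΦ∂_zΦ ≤ ½∫(∂_zΩ)² + ½∫Φ⁴` and the interpolation of `∫r²Φ⁴` -/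

section SliceLemmas

variable {Ω Φ Γ : EuclideanSpace ℝ (Fin 3) → ℝ}

/-- `Φ² ∈ L²` for a bounded `Φ ∈ L²`. [folklore] -/
theorem memLp_sq_of_bound (hΦc : Continuous Φ) (hΦ2 : MemLp Φ 2 volume) {B : ℝ}
    (hB : ∀ x, |Φ x| ≤ B) : MemLp (fun x => Φ x ^ 2) 2 volume := by
  have hB0 : 0 ≤ B := (abs_nonneg _).trans (hB 0)
  refine (hΦ2.const_mul B).of_le (hΦc.pow 2).aestronglyMeasurable (ae_of_all _ fun x => ?_)
  rw [Real.norm_eq_abs, Real.norm_eq_abs, abs_pow, abs_mul, abs_of_nonneg hB0, sq]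
  exact mul_le_mul_of_nonneg_right (hB x) (abs_nonneg _)

/-- A bounded continuous multiple of an `L²` function is `L²`. [folklore] -/
theorem memLp_mul_of_bound_left {g : EuclideanSpace ℝ (Fin 3) → ℝ} (hΦc : Continuous Φ) {B : ℝ}
    (hB : ∀ x, |Φ x| ≤ B) (hg : MemLp g 2 volume) : MemLp (fun x => Φ x * g x) 2 volume := by
  have hB0 : 0 ≤ B := (abs_nonneg _).trans (hB 0)
  refine (hg.const_mul B).of_le (hΦc.aestronglyMeasurable.mul hg.1) (ae_of_all _ fun x => ?_)
  rw [Real.norm_eq_abs, Real.norm_eq_abs, abs_mul, abs_mul, abs_of_nonneg hB0]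
  exact mul_le_mul_of_nonneg_right (hB x) (abs_nonneg _)

/-- **`2 ∫ Ω Φ ∂_zΦ ≤ ½ ∫ (∂_zΩ)² + ½ ∫ Φ⁴`** (`Ω ∂_z(Φ²)` by parts, then Cauchy–Schwarz/Young
pointwise), for `Ω, Φ ∈ C¹` with `Ω, ∂_zΩ, Φ, ∂_zΦ ∈ L²` and `Φ` bounded: the source term
`−2∫ΩΦJ = 2∫ΩΦ∂_zΦ` of the `Ω`-estimate (Lei–Zhang (7-1)). [cite: LeiZhang2017, §4 (7-1) (p. 10)] -/
theorem two_mul_integral_mul_mul_fderiv_le (hΩ : ContDiff ℝ 1 Ω) (hΦ : ContDiff ℝ 1 Φ)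
    (hΩ2 : MemLp Ω 2 volume) (hΩz : MemLp (fun x => fderiv ℝ Ω x (EuclideanSpace.single 2 1)) 2 volume)
    (hΦ2 : MemLp Φ 2 volume) (hΦz : MemLp (fun x => fderiv ℝ Φ x (EuclideanSpace.single 2 1)) 2 volume)
    {B : ℝ} (hB : ∀ x, |Φ x| ≤ B) :
    2 * ∫ x, Ω x * (Φ x * fderiv ℝ Φ x (EuclideanSpace.single 2 1)) ≤
      1 / 2 * (∫ x, fderiv ℝ Ω x (EuclideanSpace.single 2 1) ^ 2) + 1 / 2 * ∫ x, Φ x ^ 4 := by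
  set e : EuclideanSpace ℝ (Fin 3) := EuclideanSpace.single 2 1 with he
  have hΩd : Differentiable ℝ Ω := hΩ.differentiable one_ne_zero
  have hΦd : Differentiable ℝ Φ := hΦ.differentiable one_ne_zero
  have hg : Differentiable ℝ fun x => Φ x ^ 2 := hΦd.pow 2
  have hDg : ∀ x, fderiv ℝ (fun y => Φ y ^ 2) x e = 2 * Φ x * fderiv ℝ Φ x e := by
    intro x
    rw [((hΦd x).hasFDerivAt.pow 2).fderiv]
    simp only [_root_.FunLike.coe_smul, Pi.smul_apply, smul_eq_mul]
    ring
  have mΦ2 : MemLp (fun x => Φ x ^ 2) 2 volume := memLp_sq_of_bound hΦ.continuous hΦ2 hB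
  have mΦDΦ : MemLp (fun x => Φ x * fderiv ℝ Φ x e) 2 volume := memLp_mul_of_bound_left hΦ.continuous hB hΦz
  -- integrable pieces
  have if'g : Integrable (fun x => fderiv ℝ Ω x e * Φ x ^ 2) volume := hΩz.integrable_mul mΦ2
  have ifg' : Integrable (fun x => Ω x * fderiv ℝ (fun y => Φ y ^ 2) x e) volume := by
    refine ((hΩ2.integrable_mul mΦDΦ).const_mul 2).congr (ae_of_all _ fun x => ?_)
    simp only [hDg, Pi.mul_apply]; ring
  have ifg : Integrable (fun x => Ω x * Φ x ^ 2) volume := hΩ2.integrable_mul mΦ2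
  have hibp := integral_mul_fderiv_eq_neg_fderiv_mul_of_integrable (μ := volume)
    (f := Ω) (g := fun y => Φ y ^ 2) (v := e) if'g ifg' ifg (fun x _ => hΩd x) (fun x _ => hg x)
  -- `2∫ΩΦ∂Φ = ∫ Ω ∂(Φ²)`
  have h2 : 2 * ∫ x, Ω x * (Φ x * fderiv ℝ Φ x e) = ∫ x, Ω x * fderiv ℝ (fun y => Φ y ^ 2) x e := by
    rw [← integral_const_mul]
    exact integral_congr_ae (ae_of_all _ fun x => by simp only [hDg]; ring)
  rw [h2, hibp]
  -- pointwise `−∂Ω Φ² ≤ ½(∂Ω)² + ½ Φ⁴`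
  have iA : Integrable (fun x => fderiv ℝ Ω x e ^ 2) volume := hΩz.integrable_sq
  have iP : Integrable (fun x => Φ x ^ 4) volume :=
    mΦ2.integrable_sq.congr (ae_of_all _ fun x => by simp only; ring)
  have hmono : ∫ x, -(fderiv ℝ Ω x e * Φ x ^ 2) ≤ ∫ x, (1 / 2 * fderiv ℝ Ω x e ^ 2 + 1 / 2 * Φ x ^ 4) :=
    integral_mono if'g.neg ((iA.const_mul _).add (iP.const_mul _)) fun x => by
      nlinarith [sq_nonneg (fderiv ℝ Ω x e + Φ x ^ 2)]
  rw [integral_neg] at hmono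
  rw [integral_add (iA.const_mul _) (iP.const_mul _), integral_const_mul, integral_const_mul] at hmono
  exact hmono

/-- **Interpolation `∫ |Φ|³|Γ| ≤ (∫Φ⁴)^{1/2} (∫Φ⁴ · M²∫Γ²)^{1/4}`** (Cauchy–Schwarz twice:
`∫Φ²·|ΦΓ| ≤ ‖Φ²‖₂‖ΦΓ‖₂`, `‖ΦΓ‖₂² ≤ ‖Φ²‖₂‖Γ²‖₂`, `‖Γ²‖₂² ≤ M²‖Γ‖₂²`), for bounded continuous
`Φ, Γ ∈ L²`, `|Γ| ≤ M`: the smooth form of Lei–Zhang's `‖V‖⁴_{L⁴} ≲ ‖r⁻¹V²‖^{3/2}_{L²}‖Γ‖_{L⁴}`,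
`‖Γ‖_{L⁴} ≤ ‖Γ‖^{1/2}_{L²}‖Γ‖^{1/2}_{L^∞}`. [cite: LeiZhang2017, §4 (before (7-2)) (p. 10)] -/
theorem integral_abs_pow_three_mul_abs_le (hΦc : Continuous Φ) (hΓc : Continuous Γ)
    (hΦ2 : MemLp Φ 2 volume) (hΓ2 : MemLp Γ 2 volume) {B : ℝ} (hB : ∀ x, |Φ x| ≤ B)
    {M : ℝ} (hM : ∀ x, |Γ x| ≤ M) :
    ∫ x, |Φ x| ^ 3 * |Γ x| ≤
      Real.sqrt (∫ x, Φ x ^ 4) * Real.sqrt (Real.sqrt ((∫ x, Φ x ^ 4) * (M ^ 2 * ∫ x, Γ x ^ 2))) := by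
  have hM0 : 0 ≤ M := (abs_nonneg _).trans (hM 0)
  have mΦ2 : MemLp (fun x => Φ x ^ 2) 2 volume := memLp_sq_of_bound hΦc hΦ2 hB
  have mΓ2 : MemLp (fun x => Γ x ^ 2) 2 volume := memLp_sq_of_bound hΓc hΓ2 hM
  have mΦΓ : MemLp (fun x => |Φ x| * |Γ x|) 2 volume := by
    have h := memLp_mul_of_bound_left (Φ := fun x => |Φ x|) (g := fun x => |Γ x|)
      (continuous_abs.comp hΦc) (B := B) (fun x => by simp only [abs_abs]; exact hB x) hΓ2.abs
    exact h
  -- first Cauchy–Schwarz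
  have h1 := integral_mul_le_sqrt_mul_sqrt_of_memLp mΦ2 mΦΓ
  have hL : ∫ x, Φ x ^ 2 * (|Φ x| * |Γ x|) = ∫ x, |Φ x| ^ 3 * |Γ x| :=
    integral_congr_ae (ae_of_all _ fun x => by
      simp only
      rw [← sq_abs (Φ x)]; ring)
  have hP4 : ∫ x, (Φ x ^ 2) ^ 2 = ∫ x, Φ x ^ 4 := integral_congr_ae (ae_of_all _ fun x => by simp only; ring)
  rw [hL, hP4] at h1
  refine h1.trans (mul_le_mul_of_nonneg_left (Real.sqrt_le_sqrt ?_) (Real.sqrt_nonneg _))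
  -- second Cauchy–Schwarz: `∫ Φ²Γ² ≤ √(∫Φ⁴) √(∫Γ⁴) ≤ √(∫Φ⁴) √(M²∫Γ²)`
  have h2 := integral_mul_le_sqrt_mul_sqrt_of_memLp mΦ2 mΓ2
  have hL2 : ∫ x, (|Φ x| * |Γ x|) ^ 2 = ∫ x, Φ x ^ 2 * Γ x ^ 2 :=
    integral_congr_ae (ae_of_all _ fun x => by simp only; rw [mul_pow, sq_abs, sq_abs])
  rw [hL2, hP4] at *
  refine h2.trans ?_
  rw [Real.sqrt_mul (integral_nonneg fun x => by positivity)]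
  refine mul_le_mul_of_nonneg_left (Real.sqrt_le_sqrt ?_) (Real.sqrt_nonneg _)
  -- `∫ Γ⁴ ≤ M² ∫ Γ²`
  have iΓ4 : Integrable (fun x => (Γ x ^ 2) ^ 2) volume := mΓ2.integrable_sq
  have iΓ2 : Integrable (fun x => Γ x ^ 2) volume := hΓ2.integrable_sq
  rw [← integral_const_mul]
  refine integral_mono iΓ4 (iΓ2.const_mul _) fun x => ?_
  have hx : Γ x ^ 2 ≤ M ^ 2 := by
    rw [← sq_abs]; exact pow_le_pow_left₀ (abs_nonneg _) (hM x) 2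
  simp only
  nlinarith [sq_nonneg (Γ x)]

end SliceLemmas

/-! ### The slice inequality in Tao's class -/

section Slice

variable {T : ℝ} {u₀ : EuclideanSpace ℝ (Fin 3) → EuclideanSpace ℝ (Fin 3)}
  {u : ℝ → EuclideanSpace ℝ (Fin 3) → EuclideanSpace ℝ (Fin 3)} {p : ℝ → EuclideanSpace ℝ (Fin 3) → ℝ}

/-- `√√(xy) = √√x · √√y` for `x, y ≥ 0`. [folklore] -/
theorem sqrt_sqrt_mul {x y : ℝ} (hx : 0 ≤ x) :
    Real.sqrt (Real.sqrt (x * y)) = Real.sqrt (Real.sqrt x) * Real.sqrt (Real.sqrt y) := by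
  rw [Real.sqrt_mul hx, Real.sqrt_mul (Real.sqrt_nonneg _)]
set_option maxHeartbeats 400000 in -- buildfix (bf3-g26): 160k/180k FAIL, 200k PASS at accept time; line-neutral budget line
/-- **The fixed-time differential inequality of Lei–Zhang 2017, Thm. 1.4** ((7-1)–(7-3) combined,
in the smooth variables `Φ = v^θ/r`, `Ω = ω^θ/r` and in Tao's class, `ν = 1`).  Let `(u, p)` be a
Tao-class solution on `[0, T]` with axisymmetric slices, `τ ∈ [0, T]`, and suppose `|Γ(τ)| ≤ M`,
`Γ(τ) ∈ L²` (`Γ = swirl`) and the smallness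
`C_A (‖Ω(τ)‖²_{L²} · M² ‖Γ(τ)‖²_{L²})^{1/4} ≤ 1/3` (`C_A = √N + Λ C_S` the constant of
`HouLeiLiSupBound`).  Then, with `Φ' = angVelQuot (∂ₜu τ)`, `Ω' = angVortQuot (∂ₜu τ)`,
`4 ∫ r²Φ³Φ' + 2 ∫ ΩΩ' ≤ −½ ∫ |∇Ω|² − 2 ∫ r²Φ²|∇Φ|²`: the density of
`d/dt (‖V²‖²_{L²} + ‖Ω‖²_{L²})` is nonpositive, with the dissipation `½‖∇Ω‖² + 2∫r²Φ²|∇Φ|²` to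
spare. [cite: LeiZhang2017, §4 (7-1)–(7-3) (p. 10)] -/
theorem IsTaoSolutionOn.smallSwirl_slice_le (h : IsTaoSolutionOn T 1 u₀ u p) (hT : 0 < T)
    (hax : ∀ t ∈ Icc 0 T, IsAxisymmetric (u t)) {τ : ℝ} (hτ : τ ∈ Icc 0 T)
    {M : ℝ} (hM : ∀ x, |swirl (u τ) x| ≤ M) (hΓ2 : MemLp (swirl (u τ)) 2 volume)
    (hsmall : (Real.sqrt newtonNearSqInt + newtonFarLaplacianL65 *
        SNormLESNormFDerivOfEqConst ℝ (volume : Measure (EuclideanSpace ℝ (Fin 3))) 2) *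
      Real.sqrt (Real.sqrt ((∫ x, angVortQuot (u τ) x ^ 2) * (M ^ 2 * ∫ x, swirl (u τ) x ^ 2))) ≤ 1 / 3) :
    4 * (∫ x, (x 0 ^ 2 + x 1 ^ 2) * angVelQuot (u τ) x ^ 3 *
        angVelQuot (FluidPDE.timeDerivWithin (Icc 0 T) u τ) x) +
      2 * (∫ x, angVortQuot (u τ) x * angVortQuot (FluidPDE.timeDerivWithin (Icc 0 T) u τ) x) ≤
      -(1 / 2) * (∫ x, (fderiv ℝ (angVortQuot (u τ)) x (EuclideanSpace.single 0 1) ^ 2 +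
          fderiv ℝ (angVortQuot (u τ)) x (EuclideanSpace.single 1 1) ^ 2 +
          fderiv ℝ (angVortQuot (u τ)) x (EuclideanSpace.single 2 1) ^ 2))
        - 2 * ∫ x, (x 0 ^ 2 + x 1 ^ 2) * angVelQuot (u τ) x ^ 2 *
          (fderiv ℝ (angVelQuot (u τ)) x (EuclideanSpace.single 0 1) ^ 2 +
            fderiv ℝ (angVelQuot (u τ)) x (EuclideanSpace.single 1 1) ^ 2 +
            fderiv ℝ (angVelQuot (u τ)) x (EuclideanSpace.single 2 1) ^ 2) := by
  -- abbreviations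
  set e : Fin 3 → EuclideanSpace ℝ (Fin 3) := fun i => EuclideanSpace.single i 1 with he_def
  have he' : ∀ i, EuclideanSpace.single i (1 : ℝ) = e i := fun i => rfl
  set Φ : EuclideanSpace ℝ (Fin 3) → ℝ := angVelQuot (u τ) with hΦ_def
  set Ω : EuclideanSpace ℝ (Fin 3) → ℝ := angVortQuot (u τ) with hΩ_def
  set W : EuclideanSpace ℝ (Fin 3) → ℝ := radVelQuot (u τ) with hW_def
  set Φ' : EuclideanSpace ℝ (Fin 3) → ℝ := angVelQuot (FluidPDE.timeDerivWithin (Icc 0 T) u τ) with hΦ'_def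
  set Ω' : EuclideanSpace ℝ (Fin 3) → ℝ := angVortQuot (FluidPDE.timeDerivWithin (Icc 0 T) u τ) with hΩ'_def
  set CA : ℝ := Real.sqrt newtonNearSqInt + newtonFarLaplacianL65 *
    SNormLESNormFDerivOfEqConst ℝ (volume : Measure (EuclideanSpace ℝ (Fin 3))) 2 with hCA
  set ρ : EuclideanSpace ℝ (Fin 3) → ℝ := fun y => y 0 ^ 2 + y 1 ^ 2 with hρ_def
  have hρ' : ∀ x : EuclideanSpace ℝ (Fin 3), x 0 ^ 2 + x 1 ^ 2 = ρ x := fun x => rfl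
  have hρ0 : ∀ x, 0 ≤ ρ x := fun x => by rw [← hρ']; positivity
  simp only [he', hρ'] at hsmall ⊢
  -- Tao-class facts at `τ`
  have hcl := h.classical
  have hsm : IsSmoothSpaceTimeOn (Icc 0 T) u := hcl.smooth_velocity
  have hU : UniqueDiffOn ℝ (Icc 0 T) := uniqueDiffOn_Icc hT
  have hIcl : Icc 0 T ⊆ closure (interior (Icc 0 T)) := by
    rw [interior_Icc, closure_Ioo hT.ne]
  have hu : ContDiff ℝ ∞ (u τ) := hcl.contDiff_velocity hτ
  have hu3 : ContDiff ℝ 3 (u τ) := hu.of_le (by norm_cast)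
  have hu2 : ContDiff ℝ 2 (u τ) := hu.of_le (by norm_cast)
  have haxτ : IsAxisymmetric (u τ) := hax τ hτ
  have hdiv : VectorCalculus.IsDivFree (u τ) := hcl.divFree τ hτ
  have hH : ∀ n : ℕ, ∫⁻ x, ‖iteratedFDeriv ℝ n (u τ) x‖ₑ ^ 2 < ⊤ := fun n => by
    obtain ⟨C, hC⟩ := h.sobolev n
    exact (hC τ hτ).trans_lt ENNReal.coe_lt_top
  have hut : ContDiff ℝ ∞ (FluidPDE.timeDerivWithin (Icc 0 T) u τ) := hsm.contDiff_timeDerivWithin_slice hU hτ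
  have haxt : IsAxisymmetric (FluidPDE.timeDerivWithin (Icc 0 T) u τ) :=
    hsm.isAxisymmetric_timeDerivWithin hax hτ
  have hHt : ∀ n : ℕ, ∫⁻ x, ‖iteratedFDeriv ℝ n (FluidPDE.timeDerivWithin (Icc 0 T) u τ) x‖ₑ ^ 2 < ⊤ := fun n => by
    obtain ⟨C, hC⟩ := h.sobolev_dt n
    exact (hC τ hτ).trans_lt ENNReal.coe_lt_top
  obtain ⟨B, -, hB⟩ := h.exists_bound_velocity
  obtain ⟨B1, -, hB1⟩ := h.sobolev.exists_forall_norm_iteratedFDeriv_le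
    (fun t ht => hcl.contDiff_velocity ht) 1
  have hDb : ∀ x, ‖fderiv ℝ (u τ) x‖ ≤ B1 := fun x => by
    have := hB1 τ hτ x
    rwa [← norm_iteratedFDeriv_fderiv (n := 0), norm_iteratedFDeriv_zero] at this
  -- the quotients
  have hΦ : ContDiff ℝ ∞ Φ := contDiff_angVelQuot_of_contDiff hu
  have hΩ : ContDiff ℝ ∞ Ω := contDiff_angVortQuot_of_contDiff hu
  have hW : ContDiff ℝ ∞ W := contDiff_radVelQuot_of_contDiff hu
  have hΦfin := haxτ.lintegral_sq_iteratedFDeriv_angVelQuot_lt_top hu hH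
  have hΩfin := haxτ.lintegral_sq_iteratedFDeriv_angVortQuot_lt_top hu hH
  have hΦ'fin := haxt.lintegral_sq_iteratedFDeriv_angVelQuot_lt_top hut hHt
  have hΩ'fin := haxt.lintegral_sq_iteratedFDeriv_angVortQuot_lt_top hut hHt
  have hne := norm_euclideanSpace_single_one_le
  have m0Φ : MemLp Φ 2 volume := memLp_of_sobolev hΦ hΦfin
  have m1Φ : ∀ i, MemLp (fun x => fderiv ℝ Φ x (e i)) 2 volume := fun i =>
    memLp_fderiv_apply_of_sobolev hΦ hΦfin (hne i)
  have m2Φ : ∀ i, MemLp (fun x => fderiv ℝ (fun y => fderiv ℝ Φ y (e i)) x (e i)) 2 volume := fun i =>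
    memLp_fderiv_fderiv_apply_of_sobolev hΦ hΦfin (hne i) (hne i)
  have mΦ' : MemLp Φ' 2 volume := memLp_of_sobolev (contDiff_angVelQuot_of_contDiff hut) hΦ'fin
  have m0Ω : MemLp Ω 2 volume := memLp_of_sobolev hΩ hΩfin
  have m1Ω : ∀ i, MemLp (fun x => fderiv ℝ Ω x (e i)) 2 volume := fun i =>
    memLp_fderiv_apply_of_sobolev hΩ hΩfin (hne i)
  have m2Ω : ∀ i, MemLp (fun x => fderiv ℝ (fun y => fderiv ℝ Ω y (e i)) x (e i)) 2 volume := fun i =>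
    memLp_fderiv_fderiv_apply_of_sobolev hΩ hΩfin (hne i) (hne i)
  have mΩ' : MemLp Ω' 2 volume := memLp_of_sobolev (contDiff_angVortQuot_of_contDiff hut) hΩ'fin
  have mqΩ : MemLp (radDerivQuot Ω) 2 volume := (memLp_radDerivQuot_of_sobolev hΩ hΩfin).1
  -- sup bounds of `Φ`, `W`
  set c : ℝ := ‖(curlCLM : (EuclideanSpace ℝ (Fin 3) →L[ℝ] EuclideanSpace ℝ (Fin 3)) →L[ℝ]
      EuclideanSpace ℝ (Fin 3))‖ with hc_def
  have hΦB : ∀ x, |Φ x| ≤ c * B1 / 2 := fun x => by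
    have := haxτ.norm_iteratedFDeriv_angVelQuot_le hu 0 (fun y => hB1 τ hτ y) x
    rwa [norm_iteratedFDeriv_zero, Real.norm_eq_abs] at this
  have hWB : ∀ x, |W x| ≤ c * B1 / 2 := fun x => by
    have := haxτ.norm_iteratedFDeriv_radVelQuot_le hu 0 (fun y => hB1 τ hτ y) x
    rwa [norm_iteratedFDeriv_zero, Real.norm_eq_abs] at this
  have hBΦ0 : 0 ≤ c * B1 / 2 := (abs_nonneg _).trans (hΦB 0)
  have hB₂ : ∀ x, ρ x * Φ x ^ 2 ≤ B ^ 2 := fun x =>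
    (haxτ.horizSq_mul_angVelQuot_sq_le hu2 x).trans (pow_le_pow_left₀ (norm_nonneg _) (hB τ hτ x) 2)
  ------------------------------------------------------------------
  -- (1) the `Φ⁴`-identity: `I1 = −3 DA − (3/2) IW`
  ------------------------------------------------------------------
  have hD1 := hcl.integral_horizSq_mul_angVelQuot_cube_eq hU hax hτ m0Φ m1Φ m2Φ mΦ' hΦB (hB τ hτ)
    hDb hWB
  simp only [he', hρ', ← hΦ_def, ← hΦ'_def, ← hW_def] at hD1
  ------------------------------------------------------------------
  -- (2) the `Ω`-inequality: `I2 + X ≤ 2∫ΩΦ∂_zΦ ≤ ½a + ½P`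
  ------------------------------------------------------------------
  have hJ : ∀ x, radVelQuot (FluidPDE.curl (u τ)) x = -fderiv ℝ Φ x (e 2) := fun x =>
    haxτ.radVelQuot_curl_eq_neg_fderiv_angVelQuot hu3 x
  have hRfun : (fun x => Ω x * (Φ x * radVelQuot (FluidPDE.curl (u τ)) x)) =
      fun x => -(Ω x * (Φ x * fderiv ℝ Φ x (e 2))) := by
    funext x; rw [hJ]; ring
  have mΦDΦ : MemLp (fun x => Φ x * fderiv ℝ Φ x (e 2)) 2 volume :=
    memLp_mul_of_bound_left hΦ.continuous hΦB (m1Φ 2)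
  have hRint : Integrable (fun x => Ω x * (Φ x * radVelQuot (FluidPDE.curl (u τ)) x)) volume := by
    rw [hRfun]; exact (m0Ω.integrable_mul mΦDΦ).neg
  have hD2 := hcl.angVortQuot_energy_le hU hIcl hax zero_le_one hτ m0Ω m1Ω m2Ω mqΩ hRint (hB τ hτ) hDb
  simp only [he', ← hΩ_def, ← hΩ'_def, ← hΦ_def] at hD2
  have hD2' : -2 * ∫ x, Ω x * (Φ x * radVelQuot (FluidPDE.curl (u τ)) x) =
      2 * ∫ x, Ω x * (Φ x * fderiv ℝ Φ x (e 2)) := by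
    rw [hRfun, integral_neg]; ring
  have hD2'' := two_mul_integral_mul_mul_fderiv_le (contDiff_infty.1 hΩ 1) (contDiff_infty.1 hΦ 1)
    m0Ω (m1Ω 2) m0Φ (m1Φ 2) hΦB
  ------------------------------------------------------------------
  -- (3) Hardy: `P ≤ 4 DAh ≤ 4 DA`
  ------------------------------------------------------------------
  have hD3 := integral_pow_four_le_four_mul (contDiff_infty.1 hΦ 1) m0Φ m1Φ hΦB hB₂
  -- integrability of the dissipation densities
  have cDΦ : ∀ v, Continuous fun x => fderiv ℝ Φ x v := fun v =>
    (hΦ.continuous_fderiv (by simp)).clm_apply continuous_const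
  have cP : Continuous fun x => ρ x * Φ x ^ 2 := (contDiff_horizSq (n := 0)).continuous.mul (hΦ.continuous.pow 2)
  have bP : ∀ x, ‖ρ x * Φ x ^ 2‖ ≤ B ^ 2 := fun x => by
    rw [Real.norm_of_nonneg (mul_nonneg (hρ0 x) (sq_nonneg _))]; exact hB₂ x
  have key : ∀ {f g : EuclideanSpace ℝ (Fin 3) → ℝ} {C : ℝ}, Continuous f → (∀ x, ‖f x‖ ≤ C) →
      Integrable g volume → Integrable (fun x => f x * g x) volume :=
    fun hf hC hg => hg.bdd_mul hf.aestronglyMeasurable (ae_of_all _ hC)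
  have iDD : ∀ i, Integrable (fun x => fderiv ℝ Φ x (e i) ^ 2) volume := fun i => (m1Φ i).integrable_sq
  have iDAh : Integrable (fun x => ρ x * Φ x ^ 2 * (fderiv ℝ Φ x (e 0) ^ 2 + fderiv ℝ Φ x (e 1) ^ 2)) volume :=
    key cP bP ((iDD 0).add (iDD 1))
  have iDA : Integrable (fun x => ρ x * Φ x ^ 2 * (fderiv ℝ Φ x (e 0) ^ 2 + fderiv ℝ Φ x (e 1) ^ 2 +
      fderiv ℝ Φ x (e 2) ^ 2)) volume := key cP bP (((iDD 0).add (iDD 1)).add (iDD 2))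
  have hDAh : ∫ x, ρ x * Φ x ^ 2 * (fderiv ℝ Φ x (e 0) ^ 2 + fderiv ℝ Φ x (e 1) ^ 2) ≤
      ∫ x, ρ x * Φ x ^ 2 * (fderiv ℝ Φ x (e 0) ^ 2 + fderiv ℝ Φ x (e 1) ^ 2 + fderiv ℝ Φ x (e 2) ^ 2) :=
    integral_mono iDAh iDA fun x => by
      have : 0 ≤ ρ x * Φ x ^ 2 := mul_nonneg (hρ0 x) (sq_nonneg _)
      beta_reduce
      nlinarith [sq_nonneg (fderiv ℝ Φ x (e 2))]
  have iOD : ∀ i, Integrable (fun x => fderiv ℝ Ω x (e i) ^ 2) volume := fun i => (m1Ω i).integrable_sq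
  have iX : Integrable (fun x => fderiv ℝ Ω x (e 0) ^ 2 + fderiv ℝ Ω x (e 1) ^ 2 + fderiv ℝ Ω x (e 2) ^ 2) volume :=
    ((iOD 0).add (iOD 1)).add (iOD 2)
  have ha : ∫ x, fderiv ℝ Ω x (e 2) ^ 2 ≤
      ∫ x, (fderiv ℝ Ω x (e 0) ^ 2 + fderiv ℝ Ω x (e 1) ^ 2 + fderiv ℝ Ω x (e 2) ^ 2) :=
    integral_mono (iOD 2) iX fun x => by
      beta_reduce; nlinarith [sq_nonneg (fderiv ℝ Ω x (e 0)), sq_nonneg (fderiv ℝ Ω x (e 1))]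
  ------------------------------------------------------------------
  -- (4) the sup bound of `W`: `|W| ≤ CA √√(Bq · a)`
  ------------------------------------------------------------------
  have hBq0 : 0 ≤ ∫ x, Ω x ^ 2 := integral_nonneg fun x => sq_nonneg _
  have ha0 : 0 ≤ ∫ x, fderiv ℝ Ω x (e 2) ^ 2 := integral_nonneg fun x => sq_nonneg _
  have hWsup : ∀ x, |W x| ≤ CA * Real.sqrt (Real.sqrt ((∫ y, Ω y ^ 2) * ∫ y, fderiv ℝ Ω y (e 2) ^ 2)) := by
    intro x
    have hh := haxτ.abs_radVelQuot_le_of_sobolev hu hdiv hH x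
    simp only [he', ← hΩ_def, ← hW_def] at hh
    -- `√√y = y^{1/4}` (cf. `SelbergMollifier.sqrt_sqrt_eq_rpow_quarter`)
    have hq : ∀ {y : ℝ}, 0 ≤ y → Real.sqrt (Real.sqrt y) = y ^ (1 / 4 : ℝ) := fun hy => by
      rw [Real.sqrt_eq_rpow, Real.sqrt_eq_rpow, ← Real.rpow_mul hy]; norm_num
    rwa [← hq (mul_nonneg hBq0 ha0)] at hh
  -- `−IW ≤ Wsup · A`
  have m2sq : MemLp (fun x => Φ x ^ 2) 2 volume := memLp_sq_of_bound hΦ.continuous m0Φ hΦB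
  have iΦ2 : Integrable (fun x => Φ x ^ 2) volume := m0Φ.integrable_sq
  have iA : Integrable (fun x => ρ x * Φ x ^ 4) volume :=
    (key cP bP iΦ2).congr (ae_of_all _ fun x => by beta_reduce; ring)
  have iIW : Integrable (fun x => ρ x * W x * Φ x ^ 4) volume :=
    (key hW.continuous (fun x => by rw [Real.norm_eq_abs]; exact hWB x) iA).congr
      (ae_of_all _ fun x => by beta_reduce; ring)
  have hA0 : 0 ≤ ∫ x, ρ x * Φ x ^ 4 := integral_nonneg fun x => mul_nonneg (hρ0 x) (by positivity)
  set Wsup : ℝ := CA * Real.sqrt (Real.sqrt ((∫ y, Ω y ^ 2) * ∫ y, fderiv ℝ Ω y (e 2) ^ 2)) with hWsup_def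
  have hWsup0 : 0 ≤ Wsup := (abs_nonneg _).trans (hWsup 0)
  have hIW : -(∫ x, ρ x * W x * Φ x ^ 4) ≤ Wsup * ∫ x, ρ x * Φ x ^ 4 := by
    rw [← integral_neg, ← integral_const_mul]
    refine integral_mono iIW.neg (iA.const_mul _) fun x => ?_
    beta_reduce
    have hρΦ : 0 ≤ ρ x * Φ x ^ 4 := mul_nonneg (hρ0 x) (by positivity)
    have hw := hWsup x
    have : -(W x) ≤ Wsup := by linarith [neg_abs_le (W x)]
    nlinarith
  ------------------------------------------------------------------
  -- (5) interpolation: `A = ∫ |Φ|³|Γ| ≤ √P √√(P M² G)`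
  ------------------------------------------------------------------
  have hΓρ : ∀ x, swirl (u τ) x = ρ x * Φ x := fun x => by
    rw [← hρ', ← cylRadius_sq]; exact (haxτ.cylRadius_sq_mul_angVelQuot hu2 x).symm
  have hA_eq : ∫ x, ρ x * Φ x ^ 4 = ∫ x, |Φ x| ^ 3 * |swirl (u τ) x| := by
    refine integral_congr_ae (ae_of_all _ fun x => ?_)
    beta_reduce
    rw [hΓρ x, abs_mul, abs_of_nonneg (hρ0 x),
      show |Φ x| ^ 3 * (ρ x * |Φ x|) = ρ x * |Φ x| ^ 4 by ring, Even.pow_abs ⟨2, rfl⟩]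
  have hD5 := integral_abs_pow_three_mul_abs_le hΦ.continuous (contDiff_swirl hu).continuous m0Φ hΓ2 hΦB hM
  ------------------------------------------------------------------
  -- (6) assembly
  ------------------------------------------------------------------
  -- names of the real numbers
  set I1 : ℝ := ∫ x, ρ x * Φ x ^ 3 * Φ' x with hI1
  set I2 : ℝ := ∫ x, Ω x * Ω' x with hI2
  set X : ℝ := ∫ x, (fderiv ℝ Ω x (e 0) ^ 2 + fderiv ℝ Ω x (e 1) ^ 2 + fderiv ℝ Ω x (e 2) ^ 2) with hX
  set a : ℝ := ∫ x, fderiv ℝ Ω x (e 2) ^ 2 with ha_def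
  set P : ℝ := ∫ x, Φ x ^ 4 with hP
  set DA : ℝ := ∫ x, ρ x * Φ x ^ 2 * (fderiv ℝ Φ x (e 0) ^ 2 + fderiv ℝ Φ x (e 1) ^ 2 +
    fderiv ℝ Φ x (e 2) ^ 2) with hDA
  set DAh : ℝ := ∫ x, ρ x * Φ x ^ 2 * (fderiv ℝ Φ x (e 0) ^ 2 + fderiv ℝ Φ x (e 1) ^ 2) with hDAh_def
  set IW : ℝ := ∫ x, ρ x * W x * Φ x ^ 4 with hIW_def
  set A : ℝ := ∫ x, ρ x * Φ x ^ 4 with hA_def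
  set Bq : ℝ := ∫ x, Ω x ^ 2 with hBq
  set G : ℝ := ∫ x, swirl (u τ) x ^ 2 with hG
  have hP0 : 0 ≤ P := integral_nonneg fun x => by positivity
  have hG0 : 0 ≤ G := integral_nonneg fun x => sq_nonneg _
  have hDA0 : 0 ≤ DA := integral_nonneg fun x => mul_nonneg (mul_nonneg (hρ0 x) (sq_nonneg _)) (by positivity)
  -- fourth roots
  set α : ℝ := Real.sqrt (Real.sqrt a) with hα
  set π : ℝ := Real.sqrt (Real.sqrt P) with hπ
  set β : ℝ := Real.sqrt (Real.sqrt Bq) with hβ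
  set γ : ℝ := Real.sqrt (Real.sqrt (M ^ 2 * G)) with hγ
  have hα0 : 0 ≤ α := Real.sqrt_nonneg _
  have hπ0 : 0 ≤ π := Real.sqrt_nonneg _
  have hβ0 : 0 ≤ β := Real.sqrt_nonneg _
  have hγ0 : 0 ≤ γ := Real.sqrt_nonneg _
  have hsP : Real.sqrt P = π ^ 2 := (Real.sq_sqrt (Real.sqrt_nonneg _)).symm
  have hW1 : Wsup = CA * (β * α) := by rw [hWsup_def, sqrt_sqrt_mul hBq0]
  have hS : Real.sqrt (Real.sqrt (Bq * (M ^ 2 * G))) = β * γ := sqrt_sqrt_mul hBq0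
  have h5 : A ≤ π ^ 2 * (π * γ) := by
    have := hD5
    rw [← hA_eq, sqrt_sqrt_mul hP0, ← hπ, ← hγ, hsP] at this
    exact this
  have hyoung : α * (π ^ 2 * π) ≤ a / 4 + 3 * P / 4 := by
    have := young_quarter_three_quarters ha0 hP0
    rw [← hα, ← hπ, hsP] at this
    exact this
  have hsm' : CA * (β * γ) ≤ 1 / 3 := by rwa [hS] at hsmall
  -- the key product estimate: `6 Wsup A ≤ 6 CA (βγ) · (α π² π) ≤ 2 (a/4 + 3P/4)`
  have hkey : 6 * (Wsup * A) ≤ a / 2 + 3 * P / 2 := by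
    calc 6 * (Wsup * A) ≤ 6 * (CA * (β * α) * (π ^ 2 * (π * γ))) := by
          rw [hW1]
          refine mul_le_mul_of_nonneg_left (mul_le_mul_of_nonneg_left h5 ?_) (by norm_num)
          rw [← hW1]; exact hWsup0
      _ = 6 * (CA * (β * γ)) * (α * (π ^ 2 * π)) := by ring
      _ ≤ 6 * (1 / 3) * (a / 4 + 3 * P / 4) := by
          refine mul_le_mul (mul_le_mul_of_nonneg_left hsm' (by norm_num)) hyoung
            (by positivity) (by norm_num)
      _ = a / 2 + 3 * P / 2 := by ring
  -- collect
  have h1 : 4 * I1 = -12 * DA - 6 * IW := by linear_combination 4 * hD1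
  have h2 : 2 * I2 + 2 * X ≤ a + P := by
    have := hD2
    rw [hD2'] at this
    linarith [hD2'']
  have h3 : P ≤ 4 * DA := hD3.trans (by linarith [hDAh])
  have h4 : -IW ≤ Wsup * A := hIW
  linarith [hkey, h1, h2, h3, h4, ha]

end Slice

end Literature.Analysis.FluidPDE

end
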